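import Mathlib
import HarnessLib

/-!
# Donsker–Varadhan transfer arithmetic: Hölder over shifts under an invariant measure and the one-cell bounds

Topic `Literature/Probability/Entropy`. The relative entropy method controls the law `μ` of a system
started out of equilibrium only through its entropy `H(μ | ν)` relative to an INVARIANT reference law
`ν` and the entropy inequality `∫ B dμ ≤ λ⁻¹ (H(μ | ν) + log ∫ e^{λ B} dν)` (Kipnis–Landim 1999,
Appendix 1 §8; Donsker–Varadhan 1975). Everything else is an estimate of an EXPONENTIAL MOMENT under
the invariant law `ν`, and two elementary steps recur in every such estimate ("Donsker–Varadhan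
transfer", "one-block / two-blocks", Kipnis–Landim Ch. 5–6; Olla–Varadhan–Yau 1993 §3–4):

* **Hölder over shifts (time windows) is lossless under an invariant measure.** If `T₁, …, T_W`
  preserve `μ` then `∫ exp(∑_w f ∘ T_w) dμ ≤ ∫ exp(W f) dμ`: pointwise
  `exp(∑_w a_w) = exp(W⁻¹ ∑_w W a_w) ≤ W⁻¹ ∑_w exp(W a_w)` (Jensen for `exp`, equivalently AM–GM for
  the numbers `e^{W a_w}`, `exp_sum_le_card_inv_mul_sum_exp`), then invariance term by term. We prove
  the `lintegral` form for a finite family of measure-preserving maps and possibly different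
  observables (`lintegral_exp_sum_comp_le_avg`, `lintegral_exp_sum_comp_le`), the iterate form
  `T_w = T^[w]`, `w < W` (`lintegral_exp_sum_range_iterate_le`), and the Bochner forms under the
  integrability of `exp(W f)` (`integrable_exp_sum_comp`, `integral_exp_sum_comp_le`,
  `integral_exp_sum_range_iterate_le`, `log_integral_exp_sum_range_iterate_le`). No finiteness of
  `μ` is needed.
* **The one-cell bound.** For `0 ≤ b ≤ 1`, `exp(a b) ≤ 1 + (e^a − 1) b` (chord of the convex `exp`
  on `[0, a]`, `exp_mul_le_one_add_expm1_mul`); hence under a probability measure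
  `∫ exp(a B) dμ ≤ 1 + (e^a − 1) ∫ B dμ` for `0 ≤ B ≤ 1` (`integral_exp_mul_le_one_add`) and, for
  `a ≥ 0`, `log ∫ exp(a B) dμ ≤ (e^a − 1) ∫ B dμ` (`log_integral_exp_mul_le`), through
  `log(1 + p (e^a − 1)) ≤ p (e^a − 1)` (`log_one_add_mul_expm1_le`, from `log x ≤ x − 1`).
* **The choice of `λ`.** The bookkeeping that closes a budget-`K` transfer at a fixed threshold:
  if `b ≤ K/λ + p e^{λ n}/(λ n)` with `λ = K/δ` and `p ≤ δ λ n e^{−λ n}` then `b ≤ 2δ`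
  (`le_two_mul_of_transfer_bound`).

Sources: C. Kipnis, C. Landim, *Scaling Limits of Interacting Particle Systems* (1999), Appendix 1
§8 and Ch. 6 §1; S. Olla, S. R. S. Varadhan, H.-T. Yau, Comm. Math. Phys. 155 (1993) §3. All
statements here are folklore consequences of Jensen's inequality and are tagged `[folklore]`.

Not here: the entropy inequality itself (tree: `Literature.Probability.Divergences.integral_le_toReal_klDiv_add_integral`,
`Literature.Probability.Entropy.KipnisLandim1999_A1_8_2_holds`; Mathlib `Measure.tilted`), spatial
(block) factorisation of Gibbs measures, and any dynamics.
-/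

noncomputable section

namespace Literature.Probability.Entropy

open _root_.MeasureTheory Finset
open scoped ENNReal

/-! ## Jensen for `exp` of a finite sum -/

/-- **Jensen / AM–GM for the exponential of a finite sum**: for a nonempty finite family of reals,
`exp(∑_{i ∈ s} a_i) ≤ (#s)⁻¹ ∑_{i ∈ s} exp(#s · a_i)` — the sum is the average of the numbers
`#s · a_i`, and `exp` is convex (equivalently: the geometric mean of the `e^{#s a_i}` is at most their
arithmetic mean). [folklore] -/
theorem exp_sum_le_card_inv_mul_sum_exp {ι : Type*} (s : Finset ι) (hs : s.Nonempty) (a : ι → ℝ) :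
    Real.exp (∑ i ∈ s, a i) ≤ (s.card : ℝ)⁻¹ * ∑ i ∈ s, Real.exp (s.card * a i) := by
  have hc : (s.card : ℝ) ≠ 0 := by exact_mod_cast hs.card_pos.ne'
  have hw : (0 : ℝ) ≤ (s.card : ℝ)⁻¹ := by positivity
  have h := ConvexOn.map_sum_le convexOn_exp (t := s) (w := fun _ => (s.card : ℝ)⁻¹)
    (p := fun i => (s.card : ℝ) * a i) (fun _ _ => hw)
    (by rw [sum_const, nsmul_eq_mul, mul_inv_cancel₀ hc]) (fun _ _ => Set.mem_univ _)
  simp only [smul_eq_mul] at h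
  have hl : ∑ i ∈ s, (s.card : ℝ)⁻¹ * ((s.card : ℝ) * a i) = ∑ i ∈ s, a i :=
    sum_congr rfl fun i _ => by rw [← mul_assoc, inv_mul_cancel₀ hc, one_mul]
  rw [hl] at h
  rwa [mul_sum]

/-! ## Hölder over a family of measure-preserving maps (`lintegral` form) -/

section Lintegral

variable {Ω : Type*} [MeasurableSpace Ω] {μ : Measure Ω} {ι : Type*} {s : Finset ι}
  {T : ι → Ω → Ω}

/-- **Hölder over shifts under an invariant measure, averaged form.** If every `T_i` (`i ∈ s`,
`s` nonempty) preserves `μ` and the `f_i` are measurable, then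
`∫⁻ exp(∑_{i∈s} f_i ∘ T_i) dμ ≤ (#s)⁻¹ ∑_{i∈s} ∫⁻ exp(#s · f_i) dμ` — Jensen pointwise
(`exp_sum_le_card_inv_mul_sum_exp`), then `∫⁻ g ∘ T_i dμ = ∫⁻ g dμ` term by term. This is the
generalised Hölder inequality `∫ ∏ g_i ≤ ∏ ‖g_i‖_{#s}` followed by AM–GM, in the form that loses
nothing when all `g_i = e^{f} ∘ T_i` have the same law. [folklore] -/
theorem lintegral_exp_sum_comp_le_avg (hs : s.Nonempty) (hT : ∀ i ∈ s, MeasurePreserving (T i) μ μ)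
    {f : ι → Ω → ℝ} (hf : ∀ i ∈ s, Measurable (f i)) :
    ∫⁻ ω, ENNReal.ofReal (Real.exp (∑ i ∈ s, f i (T i ω))) ∂μ ≤
      (s.card : ℝ≥0∞)⁻¹ * ∑ i ∈ s, ∫⁻ ω, ENNReal.ofReal (Real.exp (s.card * f i ω)) ∂μ := by
  have hcpos : (0 : ℝ) < (s.card : ℝ)⁻¹ := by
    have : (0 : ℝ) < s.card := by exact_mod_cast hs.card_pos
    positivity
  have hJ : ∀ ω, Real.exp (∑ i ∈ s, f i (T i ω)) ≤
      (s.card : ℝ)⁻¹ * ∑ i ∈ s, Real.exp (s.card * f i (T i ω)) :=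
    fun ω => exp_sum_le_card_inv_mul_sum_exp s hs fun i => f i (T i ω)
  have hem : ∀ i ∈ s, Measurable fun ω => ENNReal.ofReal (Real.exp (s.card * f i ω)) :=
    fun i hi => (measurable_const.mul (hf i hi)).exp.ennreal_ofReal
  calc ∫⁻ ω, ENNReal.ofReal (Real.exp (∑ i ∈ s, f i (T i ω))) ∂μ
      ≤ ∫⁻ ω, ENNReal.ofReal ((s.card : ℝ)⁻¹) *
          ∑ i ∈ s, ENNReal.ofReal (Real.exp (s.card * f i (T i ω))) ∂μ := by
        refine lintegral_mono fun ω => ?_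
        refine (ENNReal.ofReal_le_ofReal (hJ ω)).trans_eq ?_
        rw [ENNReal.ofReal_mul hcpos.le, ENNReal.ofReal_sum_of_nonneg fun i _ => (Real.exp_pos _).le]
    _ = ENNReal.ofReal ((s.card : ℝ)⁻¹) *
          ∑ i ∈ s, ∫⁻ ω, ENNReal.ofReal (Real.exp (s.card * f i (T i ω))) ∂μ := by
        rw [lintegral_const_mul' _ _ ENNReal.ofReal_ne_top,
          lintegral_finsetSum' _ fun i hi =>
            (show Measurable fun ω => ENNReal.ofReal (Real.exp (s.card * f i (T i ω))) from
              (hem i hi).comp (hT i hi).measurable).aemeasurable]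
    _ = (s.card : ℝ≥0∞)⁻¹ * ∑ i ∈ s, ∫⁻ ω, ENNReal.ofReal (Real.exp (s.card * f i ω)) ∂μ := by
        rw [ENNReal.ofReal_inv_of_pos (by exact_mod_cast hs.card_pos), ENNReal.ofReal_natCast]
        exact congrArg _ (sum_congr rfl fun i hi => (hT i hi).lintegral_comp (hem i hi))

/-- **Hölder over shifts under an invariant measure is lossless**: if every `T_i` (`i ∈ s`, `s`
nonempty) preserves `μ` and `f` is measurable, `∫⁻ exp(∑_{i∈s} f ∘ T_i) dμ ≤ ∫⁻ exp(#s · f) dμ`.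
Typical use: `μ` a flow-invariant (Liouville / Gibbs) law, `T_w` the flow at the start of the `w`-th
time window, `f` a one-window functional — the exponential moment of a sum over `W` windows costs no
more than that of `W` copies of ONE window. [folklore] -/
theorem lintegral_exp_sum_comp_le (hs : s.Nonempty) (hT : ∀ i ∈ s, MeasurePreserving (T i) μ μ)
    {f : Ω → ℝ} (hf : Measurable f) :
    ∫⁻ ω, ENNReal.ofReal (Real.exp (∑ i ∈ s, f (T i ω))) ∂μ ≤
      ∫⁻ ω, ENNReal.ofReal (Real.exp (s.card * f ω)) ∂μ := by
  refine (lintegral_exp_sum_comp_le_avg hs hT fun _ _ => hf).trans_eq ?_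
  rw [sum_const, nsmul_eq_mul, ← mul_assoc,
    ENNReal.inv_mul_cancel (by exact_mod_cast hs.card_pos.ne') (ENNReal.natCast_ne_top _), one_mul]

/-- **Hölder over the iterates of one measure-preserving map**: for `T` preserving `μ`, `f`
measurable and `W ≠ 0`, `∫⁻ exp(∑_{w < W} f ∘ T^[w]) dμ ≤ ∫⁻ exp(W f) dμ`. [folklore] -/
theorem lintegral_exp_sum_range_iterate_le {T : Ω → Ω} (hT : MeasurePreserving T μ μ) {f : Ω → ℝ}
    (hf : Measurable f) {W : ℕ} (hW : W ≠ 0) :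
    ∫⁻ ω, ENNReal.ofReal (Real.exp (∑ w ∈ range W, f (T^[w] ω))) ∂μ ≤
      ∫⁻ ω, ENNReal.ofReal (Real.exp (W * f ω)) ∂μ := by
  have h := lintegral_exp_sum_comp_le (μ := μ) (T := fun w : ℕ => T^[w])
    (nonempty_range_iff.2 hW) (fun w _ => hT.iterate w) hf
  rwa [card_range] at h

/-- **Hölder over colour classes, AM form**: for measurable `f_i` (`i ∈ s`, `s` nonempty) and ANY
measure, `∫⁻ exp(∑_{i∈s} f_i) dμ ≤ (#s)⁻¹ ∑_{i∈s} ∫⁻ exp(#s · f_i) dμ` (the case `T_i = id` of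
`lintegral_exp_sum_comp_le_avg`) — the step that trades a sum over `#s` sublattices (colour classes
of a block colouring) for the worst single class at `#s` times the tilt. [folklore] -/
theorem lintegral_exp_sum_le_avg (hs : s.Nonempty) {f : ι → Ω → ℝ} (hf : ∀ i ∈ s, Measurable (f i)) :
    ∫⁻ ω, ENNReal.ofReal (Real.exp (∑ i ∈ s, f i ω)) ∂μ ≤
      (s.card : ℝ≥0∞)⁻¹ * ∑ i ∈ s, ∫⁻ ω, ENNReal.ofReal (Real.exp (s.card * f i ω)) ∂μ :=
  lintegral_exp_sum_comp_le_avg (T := fun _ => id) hs (fun _ _ => MeasurePreserving.id μ) hf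

end Lintegral

/-! ## Hölder over a family of measure-preserving maps (Bochner form) -/

section Bochner

variable {Ω : Type*} [MeasurableSpace Ω] {μ : Measure Ω} {ι : Type*} {s : Finset ι}
  {T : ι → Ω → Ω}

/-- Integrability of `exp(∑_{i∈s} f ∘ T_i)` from that of `exp(#s · f)`, the `T_i` preserving `μ`
(domination by the Jensen majorant `(#s)⁻¹ ∑_i exp(#s f) ∘ T_i`, each term integrable by
invariance). [folklore] -/
theorem integrable_exp_sum_comp (hs : s.Nonempty) (hT : ∀ i ∈ s, MeasurePreserving (T i) μ μ)
    {f : Ω → ℝ} (hf : Measurable f) (hint : Integrable (fun ω => Real.exp (s.card * f ω)) μ) :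
    Integrable (fun ω => Real.exp (∑ i ∈ s, f (T i ω))) μ := by
  have hmeas : Measurable fun ω => Real.exp (∑ i ∈ s, f (T i ω)) :=
    (Finset.measurable_sum s fun i hi => hf.comp (hT i hi).measurable).exp
  have hmaj : Integrable (fun ω => (s.card : ℝ)⁻¹ * ∑ i ∈ s, Real.exp (s.card * f (T i ω))) μ := by
    refine Integrable.const_mul (integrable_finsetSum s fun i hi => ?_) _
    exact (hT i hi).integrable_comp_of_integrable hint
  refine hmaj.mono' hmeas.aestronglyMeasurable (ae_of_all _ fun ω => ?_)
  rw [Real.norm_eq_abs, abs_of_pos (Real.exp_pos _)]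
  exact exp_sum_le_card_inv_mul_sum_exp s hs fun i => f (T i ω)

/-- **Hölder over shifts under an invariant measure, Bochner form**: if every `T_i` (`i ∈ s`, `s`
nonempty) preserves `μ`, `f` is measurable and `exp(#s · f)` is `μ`-integrable, then
`∫ exp(∑_{i∈s} f ∘ T_i) dμ ≤ ∫ exp(#s · f) dμ`. [folklore] -/
theorem integral_exp_sum_comp_le (hs : s.Nonempty) (hT : ∀ i ∈ s, MeasurePreserving (T i) μ μ)
    {f : Ω → ℝ} (hf : Measurable f) (hint : Integrable (fun ω => Real.exp (s.card * f ω)) μ) :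
    ∫ ω, Real.exp (∑ i ∈ s, f (T i ω)) ∂μ ≤ ∫ ω, Real.exp (s.card * f ω) ∂μ := by
  have hc : (s.card : ℝ) ≠ 0 := by exact_mod_cast hs.card_pos.ne'
  have hI : ∀ i ∈ s, Integrable (fun ω => Real.exp (s.card * f (T i ω))) μ :=
    fun i hi => (hT i hi).integrable_comp_of_integrable hint
  have heq : ∀ i ∈ s, ∫ ω, Real.exp (s.card * f (T i ω)) ∂μ = ∫ ω, Real.exp (s.card * f ω) ∂μ := by
    intro i hi
    have hsm : AEStronglyMeasurable (fun ω => Real.exp (s.card * f ω)) (μ.map (T i)) := by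
      rw [(hT i hi).map_eq]; exact hint.aestronglyMeasurable
    rw [← integral_map (hT i hi).measurable.aemeasurable hsm, (hT i hi).map_eq]
  calc ∫ ω, Real.exp (∑ i ∈ s, f (T i ω)) ∂μ
      ≤ ∫ ω, (s.card : ℝ)⁻¹ * ∑ i ∈ s, Real.exp (s.card * f (T i ω)) ∂μ :=
        integral_mono (integrable_exp_sum_comp hs hT hf hint)
          ((integrable_finsetSum s hI).const_mul _)
          fun ω => exp_sum_le_card_inv_mul_sum_exp s hs fun i => f (T i ω)
    _ = (s.card : ℝ)⁻¹ * ∑ i ∈ s, ∫ ω, Real.exp (s.card * f ω) ∂μ := by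
        rw [integral_const_mul, integral_finsetSum s hI]
        exact congrArg _ (sum_congr rfl heq)
    _ = ∫ ω, Real.exp (s.card * f ω) ∂μ := by
        rw [sum_const, nsmul_eq_mul, ← mul_assoc, inv_mul_cancel₀ hc, one_mul]

/-- **Hölder over the iterates of one measure-preserving map, Bochner form**: for `T` preserving
`μ`, `f` measurable with `exp(W f)` integrable and `0 < W`,
`∫ exp(∑_{w < W} f ∘ T^[w]) dμ ≤ ∫ exp(W f) dμ`. [folklore] -/
theorem integral_exp_sum_range_iterate_le {T : Ω → Ω} (hT : MeasurePreserving T μ μ) {f : Ω → ℝ}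
    (hf : Measurable f) {W : ℕ} (hW : 0 < W)
    (hint : Integrable (fun ω => Real.exp (W * f ω)) μ) :
    ∫ ω, Real.exp (∑ w ∈ Finset.range W, f (T^[w] ω)) ∂μ ≤ ∫ ω, Real.exp (W * f ω) ∂μ := by
  have h := integral_exp_sum_comp_le (μ := μ) (T := fun w : ℕ => T^[w]) (s := range W)
    (nonempty_range_iff.2 hW.ne') (fun w _ => hT.iterate w) hf (by rwa [card_range])
  rwa [card_range] at h

/-- **Log form** (the shape consumed by the entropy inequality): under a probability measure
preserved by `T`, for measurable `f` with `exp(W f)` integrable and `0 < W`,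
`log ∫ exp(∑_{w < W} f ∘ T^[w]) dμ ≤ log ∫ exp(W f) dμ`. [folklore] -/
theorem log_integral_exp_sum_range_iterate_le [IsProbabilityMeasure μ] {T : Ω → Ω}
    (hT : MeasurePreserving T μ μ) {f : Ω → ℝ} (hf : Measurable f) {W : ℕ} (hW : 0 < W)
    (hint : Integrable (fun ω => Real.exp (W * f ω)) μ) :
    Real.log (∫ ω, Real.exp (∑ w ∈ Finset.range W, f (T^[w] ω)) ∂μ) ≤
      Real.log (∫ ω, Real.exp (W * f ω) ∂μ) := by
  refine Real.log_le_log (integral_exp_pos ?_) (integral_exp_sum_range_iterate_le hT hf hW hint)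
  have h := integrable_exp_sum_comp (μ := μ) (T := fun w : ℕ => T^[w]) (s := range W)
    (nonempty_range_iff.2 hW.ne') (fun w _ => hT.iterate w) hf (by rwa [card_range])
  exact h

end Bochner

/-! ## The one-cell bounds -/

/-- **Chord bound for `exp` on `[0, a]`**: for `0 ≤ b ≤ 1`, `exp(a b) ≤ 1 + (e^a − 1) b`
(`a b = (1 − b)·0 + b·a` and `exp` is convex). [folklore] -/
theorem exp_mul_le_one_add_expm1_mul (a : ℝ) {b : ℝ} (hb0 : 0 ≤ b) (hb1 : b ≤ 1) :
    Real.exp (a * b) ≤ 1 + (Real.exp a - 1) * b := by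
  have h := convexOn_exp.2 (Set.mem_univ 0) (Set.mem_univ a) (sub_nonneg.2 hb1) hb0
    (by ring)
  simp only [smul_eq_mul, mul_zero, zero_add, Real.exp_zero, mul_one] at h
  calc Real.exp (a * b) = Real.exp (b * a) := by rw [mul_comm]
    _ ≤ 1 - b + b * Real.exp a := h
    _ = 1 + (Real.exp a - 1) * b := by ring

/-- **`log(1 + p (e^a − 1)) ≤ p (e^a − 1)`** for `0 ≤ p`, `0 ≤ a` (`log x ≤ x − 1`; the argument is
`≥ 1`). With `p = ν(bad)` this is the one-cell contribution `log E_ν exp(a 𝟙_bad) ≤ p (e^a − 1)` of a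
Donsker–Varadhan transfer. [folklore] -/
theorem log_one_add_mul_expm1_le {p a : ℝ} (hp : 0 ≤ p) (ha : 0 ≤ a) :
    Real.log (1 + p * (Real.exp a - 1)) ≤ p * (Real.exp a - 1) := by
  have h1 : 0 ≤ p * (Real.exp a - 1) :=
    mul_nonneg hp (sub_nonneg.2 (Real.one_le_exp ha))
  have := Real.log_le_sub_one_of_pos (show 0 < 1 + p * (Real.exp a - 1) by linarith)
  linarith

section OneCell

variable {Ω : Type*} [MeasurableSpace Ω] {μ : Measure Ω} [IsProbabilityMeasure μ]

/-- **One-cell exponential moment**: under a probability measure, for measurable `0 ≤ B ≤ 1` and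
any `a`, `∫ exp(a B) dμ ≤ 1 + (e^a − 1) ∫ B dμ` (integrate the chord bound). [folklore] -/
theorem integral_exp_mul_le_one_add {B : Ω → ℝ} (hBm : Measurable B) (hB0 : ∀ ω, 0 ≤ B ω)
    (hB1 : ∀ ω, B ω ≤ 1) (a : ℝ) :
    ∫ ω, Real.exp (a * B ω) ∂μ ≤ 1 + (Real.exp a - 1) * ∫ ω, B ω ∂μ := by
  have hBi : Integrable B μ := (integrable_const (1 : ℝ)).mono' hBm.aestronglyMeasurable
    (ae_of_all _ fun ω => by rw [Real.norm_eq_abs, abs_of_nonneg (hB0 ω)]; exact hB1 ω)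
  have hEi : Integrable (fun ω => Real.exp (a * B ω)) μ := by
    refine (integrable_const (Real.exp |a|)).mono' (measurable_const.mul hBm).exp.aestronglyMeasurable
      (ae_of_all _ fun ω => ?_)
    rw [Real.norm_eq_abs, abs_of_pos (Real.exp_pos _), Real.exp_le_exp]
    calc a * B ω ≤ |a * B ω| := le_abs_self _
      _ = |a| * B ω := by rw [abs_mul, abs_of_nonneg (hB0 ω)]
      _ ≤ |a| * 1 := mul_le_mul_of_nonneg_left (hB1 ω) (abs_nonneg a)
      _ = |a| := mul_one _
  calc ∫ ω, Real.exp (a * B ω) ∂μ ≤ ∫ ω, (1 + (Real.exp a - 1) * B ω) ∂μ :=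
        integral_mono hEi ((integrable_const _).add (hBi.const_mul _))
          fun ω => exp_mul_le_one_add_expm1_mul a (hB0 ω) (hB1 ω)
    _ = 1 + (Real.exp a - 1) * ∫ ω, B ω ∂μ := by
        rw [integral_add (integrable_const _) (hBi.const_mul _), integral_const, integral_const_mul]
        simp

/-- **One-cell log-moment**: under a probability measure, for measurable `0 ≤ B ≤ 1` and `a ≥ 0`,
`log ∫ exp(a B) dμ ≤ (e^a − 1) ∫ B dμ` — the bound `log(1 + p_M (e^{λ n_c} − 1)) ≤ p_M e^{λ n_c}` of a
kinetic-cell Donsker–Varadhan transfer, with `∫ B dμ` the probability that the cell is bad.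
[folklore] -/
theorem log_integral_exp_mul_le {B : Ω → ℝ} (hBm : Measurable B) (hB0 : ∀ ω, 0 ≤ B ω)
    (hB1 : ∀ ω, B ω ≤ 1) {a : ℝ} (ha : 0 ≤ a) :
    Real.log (∫ ω, Real.exp (a * B ω) ∂μ) ≤ (Real.exp a - 1) * ∫ ω, B ω ∂μ := by
  have hp : 0 ≤ ∫ ω, B ω ∂μ := integral_nonneg hB0
  have hEi : Integrable (fun ω => Real.exp (a * B ω)) μ := by
    refine (integrable_const (Real.exp a)).mono' (measurable_const.mul hBm).exp.aestronglyMeasurable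
      (ae_of_all _ fun ω => ?_)
    rw [Real.norm_eq_abs, abs_of_pos (Real.exp_pos _), Real.exp_le_exp]
    calc a * B ω ≤ a * 1 := mul_le_mul_of_nonneg_left (hB1 ω) ha
      _ = a := mul_one a
  calc Real.log (∫ ω, Real.exp (a * B ω) ∂μ)
      ≤ Real.log (1 + (∫ ω, B ω ∂μ) * (Real.exp a - 1)) := by
        refine Real.log_le_log (integral_exp_pos hEi) ?_
        rw [mul_comm]
        exact integral_exp_mul_le_one_add hBm hB0 hB1 a
    _ ≤ (∫ ω, B ω ∂μ) * (Real.exp a - 1) := log_one_add_mul_expm1_le hp ha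
    _ = (Real.exp a - 1) * ∫ ω, B ω ∂μ := mul_comm _ _

end OneCell

/-! ## The choice of `λ` -/

/-- **Closing a budget-`K` transfer at a fixed threshold.** If a quantity `b` (typically
`E_μ[bad fraction]`) obeys the Donsker–Varadhan bound `b ≤ K/λ + p e^{λ n}/(λ n)` (`K` the entropy
budget per degree of freedom, `n > 0` the cell content, `p` the reference probability of a bad cell)
with `λ = K/δ`, and `p ≤ δ (λ n) e^{−λ n}`, then `b ≤ 2δ`: the first term is `δ` by the choice of `λ`,
the second is `≤ δ` by the smallness of `p`. No rate in `p` is needed — only that `p` eventually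
beats the FIXED threshold `δ λ n e^{−λ n}`. [folklore] -/
theorem le_two_mul_of_transfer_bound {b K δ p n : ℝ} (hK : 0 < K) (hδ : 0 < δ) (hn : 0 < n)
    (hb : b ≤ K / (K / δ) + p * Real.exp (K / δ * n) / (K / δ * n))
    (hp : p ≤ δ * (K / δ * n) * Real.exp (-(K / δ * n))) : b ≤ 2 * δ := by
  have hl : 0 < K / δ := div_pos hK hδ
  have hln : 0 < K / δ * n := mul_pos hl hn
  have h1 : K / (K / δ) = δ := by field_simp
  have h2 : p * Real.exp (K / δ * n) / (K / δ * n) ≤ δ := by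
    rw [div_le_iff₀ hln]
    calc p * Real.exp (K / δ * n)
        ≤ δ * (K / δ * n) * Real.exp (-(K / δ * n)) * Real.exp (K / δ * n) :=
          mul_le_mul_of_nonneg_right hp (Real.exp_pos _).le
      _ = δ * (K / δ * n) := by
          rw [mul_assoc, ← Real.exp_add, neg_add_cancel, Real.exp_zero, mul_one]
  rw [h1] at hb
  linarith

end Literature.Probability.Entropy

end
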